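import Summits.QuantumFields.YangMills.Theorems.BalabanUVNodesN15TwoGridCellMean
import Summits.QuantumFields.YangMills.Theorems.BalabanUVNodesN15TwoGridFirstOrderLetters
import Summits.QuantumFields.YangMills.Theorems.BalabanUVNodesN15BackgroundStep
import HarnessLib

/-!
# N15 (NE2) — PROGRAMME M-III «LEVEL CURRENCY FOR THE MIXED ROW», part III-B: ★★★ THE η-DEFECT OF THE WHOLE FIRST-ORDER DRESSED JET `(X, ∇_μX)` — VALUE AND GRADIENT COMPONENTS —
# WITH NO LETTER ON `∇c′`: n15-b's stacked device with the coefficient defect SANDWICHED, its `c′`-part under the front operator `G′` by M-C and under the front operators `∇′_νG′`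
# by III-A's LEVEL SPLIT

WHO ∕ WHEN.  Cell `pub-ymgap`, seat `pub-ymgap-dag-n15-a` (KNIT-BY-NAME seat of Track-A DAG node N15 = NE2, g24); `--kind proof --supports stmt-QuantumFields-27366 --as helper` (K3⁸;
count-neutral).  THEOREMS ONLY (0 `def`).  Producers of its two row hypotheses (NOT imported): III-A `…TwoGridMeanZeroMultiplierLevels` (★★ `hasMaj_levels_comp_idef_mulOp_blockAvg_geom`), M-C (★★★ `hasMaj_comp_idef_mulOp_blockAvg_of_divAdj`); over
II-B `…TwoGridFirstOrderLetters` (`hasMaj_comp_diagK_const`, `diagK_const_mono`), n15-b B1 `…BackgroundPropagatorV` (`bgPropV`, `bgPropV_fix`, `isUnit_stepV`, `hasMaj_stepV`, `hasMaj_bgPropV`,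
`hasMaj_V_bgPropV`), B1b `…BackgroundPairSpace` (`stack`, `unstack`, `projO`, `liftPair`, `blkPair`, `bgPair`, `idef_stack`, `hasMaj_stack`, `hasMaj_unstack`, `hasMaj_projO_comp`,
`idef_unstack_apply`), g0 `BackgroundStep.idef_background_propagator_majorant_flat`, `T4EtaRateCoeffDefect.hasMaj_idef_mulOp` BY NAME; nothing in the tree is modified.

WHAT.  §26 ★★ `hasMaj_idef_bgPropV_of_sandwich` — n15-b B1's ★ `hasMaj_idef_bgPropV` with its binder (d) taken SANDWICHED (`Ĝ′∘𝔇(V̂′, V̂)∘Xh ≤ c_V·e^{−ρd}` as a hypothesis) instead of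
diagonal (generic carriers).  §27 `stack_comp`, `idef_unstack_eq` (the unstacked coefficient defect splits by components), ★★★ `hasMaj_idef_bgPair_of_sandwichRows`: on King's torus
carriers, for coarse ∕ fine pieces `G, G′` with `U ≡ 1` rows (`G, ∇_μG, G′, ∇′_μG′ ≤ βe^{−δd}`), the η-defects `𝔇(G′, G), 𝔇(∇′_μG′, ∇_μG) ≤ m_Ge^{−δd}`, the
c′-DEFECT SUPPLIED SANDWICHED AS TWO ROWS — `G′∘𝔇(M_{c′}, M_{c̄}) ≤ ζ₀e^{−δd}` (producer: M-C from the rows `G′∇′*_κ`) and `(∇′_νG′)∘𝔇(M_{c′}, M_{c̄}) ≤ ζe^{−δd}` (producers: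
III-A's LEVEL SPLIT from per-level rows, or a kernel-profile row — dag-n15-d g20's King producer I.42062) — and a fine first-order family `(c′, a′)` with `|c′|, |a′| ≤ r`, `|a′ − ā∘π| ≤ o_a`: the η-defect of the WHOLE dressed jet `Xh = bgPair G (∇∘G) c̄ ā`, `Xh′ = bgPair G′ (∇′∘G′) c′ a′` through
`(pull π, pull (liftPair π))` is `≤ TOTAL·e^{−ρd}`, every summand of `TOTAL` carrying `m_G`, `ζ₀`, `ζ` or `o_a`; ★★ `hasMaj_projO_idef_bgPair` (each component, in particular THE
GRADIENT ENTRY `𝔇(∇′_νX′, ∇_νX)`).  NO letter on `∇c′`, `∇∇a′`, no fit of `c′`; the mixed row «∇G∇*» never enters as such (only through `ζ`'s producer).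
CONSUMERS ∕ LIMITS.  The level letters are HYPOTHESES: for King's model propagator they are the rung's slices (dag-n15-d∕-e); for Bałaban's `Δ_a⁻¹` a level decomposition with per-level
rows is NOT in the tree (located) — so NO hypothesis-free corollary for the pair of record here.

HONEST FRAMING.  Block-majorant bookkeeping; no estimate of [B5]∕[B6]∕[B9]∕[King1986] asserted; abelianised scalar-multiplier MODEL of (3.52)'s `V′(A)`; NE2⁺ NOT printed ∕ proved;
no statement of record touched; N15 NOT discharged; K3⁸ OPEN; counts UNMOVED (typed 28∕28 · discharged 5∕27); NOT infinite volume ∕ OS ∕ mass gap ∕ Clay.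
-/

noncomputable section

open scoped BigOperators
open Finset

namespace Summit.QuantumFields.YangMills.BalabanUVNodes.N15.TwoGrid

open Literature.MathematicalPhysics.QuantumFieldTheory.Balaban1983to89
open Literature.MathematicalPhysics.QuantumFieldTheory.Balaban1983to89.B11SectG (BlockNorm HasMaj hasMaj_comp hasMaj_comp_exp RowSum)
open Literature.MathematicalPhysics.QuantumFieldTheory.Balaban1983to89.T4EtaRateDefect (idef idef_apply)
open Literature.MathematicalPhysics.QuantumFieldTheory.Balaban1983to89.T4EtaRateCoeffDefect (pull pull_apply diagK blockAvg hasMaj_idef_mulOp idef_mulOp_apply)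
open Literature.MathematicalPhysics.QuantumFieldTheory.Balaban1983to89.B9SectDWeightedNeumann (WRow wrow_of_exp)
open Literature.MathematicalPhysics.QuantumFieldTheory.Balaban1983to89.B6RandomWalk (Triangle254)
open Literature.MathematicalPhysics.QuantumFieldTheory.Balaban1983to89.B6Prop26Gluing (mulOp mulOp_apply)
open Literature.MathematicalPhysics.QuantumFieldTheory.Balaban1983to89.B5Prop11Plancherel (Tor fine unitVec)
open Literature.MathematicalPhysics.QuantumFieldTheory.King1986.Torus (blockOf tdistT tdistT_nonneg)
open Literature.MathematicalPhysics.QuantumFieldTheory.Balaban1983to89.B6UnitTorusCarrier (unitTorusGeo triangle254_unitTorusGeo)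
open Summit.QuantumFields.YangMills.BalabanUVNodes.N15.VectorPiece (blkFine kingPrV blkFine_comp_kingPrV)
open Summit.QuantumFields.YangMills.BalabanUVNodes.N15.BackgroundModel (kappa_ofBlocks)
open Summit.QuantumFields.YangMills.BalabanUVNodes.N15.DerivDefect (exists_const_hasMaj_ofBlocks)
open Summit.QuantumFields.YangMills.BalabanUVNodes.N15.BackgroundStep (idef_background_propagator_majorant_flat)
open Summit.QuantumFields.YangMills.BalabanUVNodes.N15.BackgroundLayer (bgPropV bgPropV_fix isUnit_stepV hasMaj_stepV hasMaj_bgPropV hasMaj_V_bgPropV stack unstack projO liftPair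
  blkPair bgPair idef_stack hasMaj_stack hasMaj_unstack hasMaj_projO_comp idef_unstack_apply abs_blockAvg_le)

variable {d : ℕ}

/-! ## §26 n15-b's jet device with the coefficient defect SANDWICHED -/

section Sandwich

variable {X X₂ X' X₂' : Type} [Fintype X] [Fintype X₂] [Fintype X'] [Fintype X₂'] [DecidableEq X] [DecidableEq X₂] [DecidableEq X'] [DecidableEq X₂']
  {g : B6.Geometry} (blk : X → g.Site) (blk₂ : X₂ → g.Site) (π : X' → X) (π₂ : X₂' → X₂)

/-- ★★ **THE η-DEFECT OF THE CONSTRUCTED PAIR, GENERAL PERTURBATION, COEFFICIENT DEFECT SANDWICHED**: n15-b B1's `hasMaj_idef_bgPropV` with binder (d) taken as the hypothesis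
`Ĝ′∘𝔇(V̂′, V̂)∘X(V̂) ≤ c_V·e^{−ρd}` (instead of `𝔇(V̂′, V̂) ≤ diagK o`): `𝔇(X(V̂′), X(V̂)) ≤ (m_Gc_r + m_Gc_r·Rβ(1−q)⁻¹ + c_V)(1−q)⁻¹·e^{−ρd}`, `q = βRc_r`.
[cite: Balaban1985BackgroundPropagators, (3.63)–(3.65) pp.402–403 (mechanism); Balaban1984PropagatorsII, (2.52)–(2.56) pp.232–233, Lemma 2.1 (2.61) p.234] -/
theorem hasMaj_idef_bgPropV_of_sandwich (htri : Triangle254 g) (hd : ∀ a b : g.Site, 0 ≤ g.dist a b) {σ cr : ℝ} (hσ : 0 ≤ σ) (hrow : RowSum g σ cr) {ρ δ β R cV mG : ℝ} (hρ : 0 ≤ ρ) (hρδ : ρ + σ ≤ δ) (hβ : 0 ≤ β) (hR : 0 ≤ R) (hcV : 0 ≤ cV) (hmG : 0 ≤ mG)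
    {G : (X → ℝ) →ₗ[ℝ] (X₂ → ℝ)} {V : (X₂ → ℝ) →ₗ[ℝ] (X → ℝ)} {G' : (X' → ℝ) →ₗ[ℝ] (X₂' → ℝ)} {V' : (X₂' → ℝ) →ₗ[ℝ] (X' → ℝ)}
    (hG : HasMaj (BlockNorm.ofBlocks g blk) (BlockNorm.ofBlocks g blk₂) G (fun y y' => β * Real.exp (-(δ * g.dist y y'))))
    (hG' : HasMaj (BlockNorm.ofBlocks g (blk ∘ π)) (BlockNorm.ofBlocks g (blk₂ ∘ π₂)) G' (fun y y' => β * Real.exp (-(δ * g.dist y y'))))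
    (hDG : HasMaj (BlockNorm.ofBlocks g blk) (BlockNorm.ofBlocks g (blk₂ ∘ π₂)) (idef (pull π) (pull π₂) G' G)
      (fun y y' => mG * Real.exp (-(δ * g.dist y y'))))
    (hV : HasMaj (BlockNorm.ofBlocks g blk₂) (BlockNorm.ofBlocks g blk) V (diagK fun _ => R))
    (hV' : HasMaj (BlockNorm.ofBlocks g (blk₂ ∘ π₂)) (BlockNorm.ofBlocks g (blk ∘ π)) V' (diagK fun _ => R))
    (hDVs : HasMaj (BlockNorm.ofBlocks g blk) (BlockNorm.ofBlocks g (blk₂ ∘ π₂)) (G' ∘ₗ idef (pull π₂) (pull π) V' V ∘ₗ bgPropV G V)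
      (fun y y' => cV * Real.exp (-(ρ * g.dist y y'))))
    (hq : β * R * cr < 1) :
    HasMaj (BlockNorm.ofBlocks g blk) (BlockNorm.ofBlocks g (blk₂ ∘ π₂)) (idef (pull π) (pull π₂) (bgPropV G' V') (bgPropV G V))
      (fun y y' => (mG * cr + 1 * (mG * cr) * (R * (β * (1 - β * R * cr)⁻¹)) + cV) * (1 - 1 * (β * R * cr))⁻¹ * Real.exp (-(ρ * g.dist y y'))) := by
  have hσδ : σ ≤ δ := by linarith
  have hq' : 0 < 1 - β * R * cr := by linarith
  have hAX : 0 ≤ β * (1 - β * R * cr)⁻¹ := mul_nonneg hβ (inv_nonneg.2 hq'.le)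
  have hfix := bgPropV_fix (isUnit_stepV blk blk₂ hd hrow hσδ hβ hR hG hV hq)
  have hfix' := bgPropV_fix (isUnit_stepV (blk ∘ π) (blk₂ ∘ π₂) hd hrow hσδ hβ hR hG' hV' hq)
  have hK' := hasMaj_stepV (blk ∘ π) (blk₂ ∘ π₂) hβ hG' hV'
  have hwrow' : WRow g ρ (fun y y' => β * R * Real.exp (-(δ * g.dist y y'))) (β * R * cr) := wrow_of_exp hd hrow (mul_nonneg hβ hR) hρδ
  have hwrowG : WRow g ρ (fun y y' => mG * Real.exp (-(δ * g.dist y y'))) (mG * cr) := wrow_of_exp hd hrow hmG hρδ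
  have hVX := hasMaj_V_bgPropV blk blk₂ htri hd hrow hσ hρ hρδ hβ hR hG hV hq
  obtain ⟨M₀, hM₀, hap⟩ := exists_const_hasMaj_ofBlocks (g := g) blk (blk₂ ∘ π₂) (idef (pull π) (pull π₂) (bgPropV G' V') (bgPropV G V))
  have hq2 : (BlockNorm.ofBlocks g (blk₂ ∘ π₂)).κ * (β * R * cr) < 1 := by rw [kappa_ofBlocks, one_mul]; exact hq
  have key := idef_background_propagator_majorant_flat (b₁ := BlockNorm.ofBlocks g blk) (b₂' := BlockNorm.ofBlocks g (blk₂ ∘ π₂))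
    (τ₁ := pull π) (τ₂ := pull π₂) (G₁ := G) (Xc := bgPropV G V) (V := V) (G₁' := G') (Xf := bgPropV G' V') (V' := V') (ρ := ρ) htri hd hρ
    (mul_nonneg hR hAX) hcV hM₀
    (fun _ _ => mul_nonneg (mul_nonneg hβ hR) (Real.exp_nonneg _)) hwrow' (fun _ _ => mul_nonneg hmG (Real.exp_nonneg _)) hwrowG
    hfix hfix' hK' hVX hDG hDVs hap hq2
  refine key.mono fun a b => le_of_eq ?_
  rfl

end Sandwich

/-! ## §27 The dressed first-order jet on King's torus carriers, `c′`-defect by M-C (front `G′`) and by the level split (fronts `∇′_νG′`) -/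

section Jet

variable {X X' J : Type} {F : Type} [AddCommGroup F] [Module ℝ F]

omit [AddCommGroup F] [Module ℝ F] in
/-- stacking after a composition: `stack G D ∘ Z = stack (G∘Z) (D_μ∘Z)`. [folklore] -/
theorem stack_comp {F₀ : Type} [AddCommGroup F₀] [Module ℝ F₀] [AddCommGroup F] [Module ℝ F] (G : F →ₗ[ℝ] (X → ℝ)) (D : J → F →ₗ[ℝ] (X → ℝ)) (Z : F₀ →ₗ[ℝ] F) :
    stack G D ∘ₗ Z = stack (G ∘ₗ Z) (fun μ => D μ ∘ₗ Z) := by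
  refine LinearMap.ext fun v => funext fun p => ?_
  rcases p with ⟨x, _ | μ⟩ <;> rfl

/-- THE UNSTACKED COEFFICIENT DEFECT SPLITS BY COMPONENTS: `𝔇(V̂′, V̂) = 𝔇(M_{c′}, M_c)∘projO none + Σ_μ 𝔇(M_{a′_μ}, M_{a_μ})∘projO (some μ)`. [folklore] -/
theorem idef_unstack_eq [Fintype J] [DecidableEq J] (π : X' → X) (c : X → ℝ) (a : J → X → ℝ) (c' : X' → ℝ) (a' : J → X' → ℝ) :
    idef (pull (liftPair π)) (pull π) (unstack c' a') (unstack c a) =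
      idef (pull π) (pull π) (mulOp c') (mulOp c) ∘ₗ projO (J := J) none + ∑ μ, idef (pull π) (pull π) (mulOp (a' μ)) (mulOp (a μ)) ∘ₗ projO (some μ) := by
  refine LinearMap.ext fun f => funext fun x' => ?_
  rw [idef_unstack_apply, LinearMap.add_apply, Pi.add_apply, LinearMap.sum_apply, Finset.sum_apply]
  simp only [LinearMap.comp_apply, idef_mulOp_apply, BackgroundLayer.projO_apply]

variable {L : ℕ} [NeZero L] (M : Fin (d + 1) → ℕ) [∀ μ, NeZero (M μ)] (k m : ℕ)

/-- ★★★ **THE η-DEFECT OF THE WHOLE FIRST-ORDER DRESSED JET, NO LETTER ON `∇c′`.**  See the module docstring (WHAT); letters `hG … hfa`, the two sandwiched `c′`-defect rows `hGc`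
(`ζ₀`) and `hDGc` (`ζ`); guards `hq` (the jets' Neumann series, `R = r(d+2)`) and `hBX` (a bound `B_X` on the jets' majorant constant `β(1 − βRc_r)⁻¹`). [cite: Balaban1985BackgroundPropagators, (3.35) p.396 (letters), (3.52) p.400, (3.62)–(3.65) pp.402–403 (mechanism); King1986, p.664 (pairing), (4.42) p.670 (levels: shape)] -/
theorem hasMaj_idef_bgPair_of_sandwichRows {σ cr : ℝ} (hσ : 0 ≤ σ) (hcr : 0 ≤ cr) (hrow : RowSum (unitTorusGeo L k M) σ cr)
    {ρ δ β mG r oa ζ₀ ζ BX : ℝ} (hρ : 0 ≤ ρ) (hρδ : ρ + σ ≤ δ) (hβ : 0 ≤ β) (hmG : 0 ≤ mG) (hr : 0 ≤ r) (hoa : 0 ≤ oa) (hζ₀ : 0 ≤ ζ₀) (hζ : 0 ≤ ζ)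
    {G : (Tor (fine (L ^ k) M) × Fin (d + 1) → ℝ) →ₗ[ℝ] (Tor (fine (L ^ k) M) × Fin (d + 1) → ℝ)}
    {G' : (Tor (fine (L ^ m * L ^ k) M) × Fin (d + 1) → ℝ) →ₗ[ℝ] (Tor (fine (L ^ m * L ^ k) M) × Fin (d + 1) → ℝ)}
    {c' : Tor (fine (L ^ m * L ^ k) M) × Fin (d + 1) → ℝ} {a' : Fin (d + 1) → Tor (fine (L ^ m * L ^ k) M) × Fin (d + 1) → ℝ}
    (hG : HasMaj (BlockNorm.ofBlocks (unitTorusGeo L k M) (blkFine L k M)) (BlockNorm.ofBlocks (unitTorusGeo L k M) (blkFine L k M)) G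
      (fun y y' => β * Real.exp (-(δ * tdistT M y y'))))
    (hGD : ∀ μ, HasMaj (BlockNorm.ofBlocks (unitTorusGeo L k M) (blkFine L k M)) (BlockNorm.ofBlocks (unitTorusGeo L k M) (blkFine L k M))
      (symbOp M (L ^ k) (sD M (L ^ k) μ ((L ^ k : ℕ) : ℝ)) ∘ₗ G) (fun y y' => β * Real.exp (-(δ * tdistT M y y'))))
    (hG' : HasMaj (BlockNorm.ofBlocks (unitTorusGeo L k M) (fun i : Tor (fine (L ^ m * L ^ k) M) × Fin (d + 1) => blockOf (L ^ m * L ^ k) M i.1))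
      (BlockNorm.ofBlocks (unitTorusGeo L k M) (fun i : Tor (fine (L ^ m * L ^ k) M) × Fin (d + 1) => blockOf (L ^ m * L ^ k) M i.1)) G'
      (fun y y' => β * Real.exp (-(δ * tdistT M y y'))))
    (hG'D : ∀ μ, HasMaj (BlockNorm.ofBlocks (unitTorusGeo L k M) (fun i : Tor (fine (L ^ m * L ^ k) M) × Fin (d + 1) => blockOf (L ^ m * L ^ k) M i.1))
      (BlockNorm.ofBlocks (unitTorusGeo L k M) (fun i : Tor (fine (L ^ m * L ^ k) M) × Fin (d + 1) => blockOf (L ^ m * L ^ k) M i.1))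
      (symbOp M (L ^ m * L ^ k) (sD M (L ^ m * L ^ k) μ ((L ^ m * L ^ k : ℕ) : ℝ)) ∘ₗ G') (fun y y' => β * Real.exp (-(δ * tdistT M y y'))))
    (hDG : HasMaj (BlockNorm.ofBlocks (unitTorusGeo L k M) (blkFine L k M))
      (BlockNorm.ofBlocks (unitTorusGeo L k M) (fun i : Tor (fine (L ^ m * L ^ k) M) × Fin (d + 1) => blockOf (L ^ m * L ^ k) M i.1))
      (idef (pull (kingPrV L k m M)) (pull (kingPrV L k m M)) G' G) (fun y y' => mG * Real.exp (-(δ * tdistT M y y'))))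
    (hDD : ∀ μ, HasMaj (BlockNorm.ofBlocks (unitTorusGeo L k M) (blkFine L k M))
      (BlockNorm.ofBlocks (unitTorusGeo L k M) (fun i : Tor (fine (L ^ m * L ^ k) M) × Fin (d + 1) => blockOf (L ^ m * L ^ k) M i.1))
      (idef (pull (kingPrV L k m M)) (pull (kingPrV L k m M)) (symbOp M (L ^ m * L ^ k) (sD M (L ^ m * L ^ k) μ ((L ^ m * L ^ k : ℕ) : ℝ)) ∘ₗ G')
        (symbOp M (L ^ k) (sD M (L ^ k) μ ((L ^ k : ℕ) : ℝ)) ∘ₗ G)) (fun y y' => mG * Real.exp (-(δ * tdistT M y y'))))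
    (hGc : HasMaj (BlockNorm.ofBlocks (unitTorusGeo L k M) (blkFine L k M))
      (BlockNorm.ofBlocks (unitTorusGeo L k M) (fun i : Tor (fine (L ^ m * L ^ k) M) × Fin (d + 1) => blockOf (L ^ m * L ^ k) M i.1))
      (G' ∘ₗ idef (pull (kingPrV L k m M)) (pull (kingPrV L k m M)) (mulOp c') (mulOp (blockAvg (kingPrV L k m M) c'))) (fun y y' => ζ₀ * Real.exp (-(δ * tdistT M y y'))))
    (hDGc : ∀ ν, HasMaj (BlockNorm.ofBlocks (unitTorusGeo L k M) (blkFine L k M))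
      (BlockNorm.ofBlocks (unitTorusGeo L k M) (fun i : Tor (fine (L ^ m * L ^ k) M) × Fin (d + 1) => blockOf (L ^ m * L ^ k) M i.1))
      ((symbOp M (L ^ m * L ^ k) (sD M (L ^ m * L ^ k) ν ((L ^ m * L ^ k : ℕ) : ℝ)) ∘ₗ G') ∘ₗ
        idef (pull (kingPrV L k m M)) (pull (kingPrV L k m M)) (mulOp c') (mulOp (blockAvg (kingPrV L k m M) c'))) (fun y y' => ζ * Real.exp (-(δ * tdistT M y y'))))
    (hc' : ∀ z, |c' z| ≤ r) (ha' : ∀ μ z, |a' μ z| ≤ r)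
    (hfa : ∀ μ z, |a' μ z - blockAvg (kingPrV L k m M) (a' μ) (kingPrV L k m M z)| ≤ oa)
    (hq : β * (r * (d + 2)) * cr < 1) (hBX : β * (1 - β * (r * (d + 2)) * cr)⁻¹ ≤ BX) :
    HasMaj (BlockNorm.ofBlocks (unitTorusGeo L k M) (blkFine L k M))
      (BlockNorm.ofBlocks (unitTorusGeo L k M) (blkPair fun i : Tor (fine (L ^ m * L ^ k) M) × Fin (d + 1) => blockOf (L ^ m * L ^ k) M i.1))
      (idef (pull (kingPrV L k m M)) (pull (liftPair (J := Fin (d + 1)) (kingPrV L k m M)))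
        (bgPair G' (fun μ => symbOp M (L ^ m * L ^ k) (sD M (L ^ m * L ^ k) μ ((L ^ m * L ^ k : ℕ) : ℝ)) ∘ₗ G') c' a')
        (bgPair G (fun μ => symbOp M (L ^ k) (sD M (L ^ k) μ ((L ^ k : ℕ) : ℝ)) ∘ₗ G) (blockAvg (kingPrV L k m M) c') (fun μ => blockAvg (kingPrV L k m M) (a' μ))))
      (fun y y' =>
        (mG * cr + 1 * (mG * cr) * (r * (d + 2) * (β * (1 - β * (r * (d + 2)) * cr)⁻¹)) +
            ((ζ₀ + (d + 1) * (β * oa)) * BX * cr + (ζ + (d + 1) * (β * oa)) * BX * cr)) *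
          (1 - 1 * (β * (r * (d + 2)) * cr))⁻¹ * Real.exp (-(ρ * tdistT M y y'))) := by
  -- geometry and bookkeeping
  have htri : Triangle254 (unitTorusGeo L k M) := triangle254_unitTorusGeo L k M
  have hd : ∀ a b : (unitTorusGeo L k M).Site, 0 ≤ (unitTorusGeo L k M).dist a b := fun a b => tdistT_nonneg M a b
  have hn0 : (0 : ℝ) ≤ (((L ^ k : ℕ) : ℝ))⁻¹ := by positivity
  have hq0 : 0 < 1 - β * (r * (d + 2)) * cr := by linarith
  set βX : ℝ := β * (1 - β * (r * (d + 2)) * cr)⁻¹ with hβX_def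
  have hβX : 0 ≤ βX := mul_nonneg hβ (inv_nonneg.2 hq0.le)
  have hBX0 : 0 ≤ BX := hβX.trans hBX
  have hR0 : 0 ≤ r * (1 + (Fintype.card (Fin (d + 1)) : ℝ)) := by positivity
  have hR : r * (1 + (Fintype.card (Fin (d + 1)) : ℝ)) ≤ r * (d + 2) := by rw [Fintype.card_fin]; push_cast; exact le_of_eq (by ring)
  have hRd : (0 : ℝ) ≤ r * (d + 2) := by positivity
  -- names
  set Dc : Fin (d + 1) → (Tor (fine (L ^ k) M) × Fin (d + 1) → ℝ) →ₗ[ℝ] (Tor (fine (L ^ k) M) × Fin (d + 1) → ℝ) :=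
    fun μ => symbOp M (L ^ k) (sD M (L ^ k) μ ((L ^ k : ℕ) : ℝ)) with hDc
  set Df : Fin (d + 1) → (Tor (fine (L ^ m * L ^ k) M) × Fin (d + 1) → ℝ) →ₗ[ℝ] (Tor (fine (L ^ m * L ^ k) M) × Fin (d + 1) → ℝ) :=
    fun μ => symbOp M (L ^ m * L ^ k) (sD M (L ^ m * L ^ k) μ ((L ^ m * L ^ k : ℕ) : ℝ)) with hDf
  set c : Tor (fine (L ^ k) M) × Fin (d + 1) → ℝ := blockAvg (kingPrV L k m M) c' with hc_def
  set a : Fin (d + 1) → Tor (fine (L ^ k) M) × Fin (d + 1) → ℝ := fun μ => blockAvg (kingPrV L k m M) (a' μ) with ha_def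
  have hc : ∀ x, |c x| ≤ r := abs_blockAvg_le (kingPrV L k m M) hr hc'
  have ha : ∀ μ x, |a μ x| ≤ r := fun μ => abs_blockAvg_le (kingPrV L k m M) hr (ha' μ)
  have hblk : blkFine L k M ∘ kingPrV L k m M = fun i : Tor (fine (L ^ m * L ^ k) M) × Fin (d + 1) => blockOf (L ^ m * L ^ k) M i.1 := blkFine_comp_kingPrV M L k m
  have hblk2 : blkPair (g := unitTorusGeo L k M) (J := Fin (d + 1)) (blkFine L k M) ∘ liftPair (kingPrV L k m M) =
      blkPair (g := unitTorusGeo L k M) fun i : Tor (fine (L ^ m * L ^ k) M) × Fin (d + 1) => blockOf (L ^ m * L ^ k) M i.1 := by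
    funext p
    exact congrFun hblk p.1
  -- the stacked `U ≡ 1` layers and their defect
  have hβe : ∀ y y' : Tor M, 0 ≤ β * Real.exp (-(δ * tdistT M y y')) := fun _ _ => mul_nonneg hβ (Real.exp_nonneg _)
  have hme : ∀ y y' : Tor M, 0 ≤ mG * Real.exp (-(δ * tdistT M y y')) := fun _ _ => mul_nonneg hmG (Real.exp_nonneg _)
  have hSG : HasMaj (BlockNorm.ofBlocks (unitTorusGeo L k M) (blkFine L k M)) (BlockNorm.ofBlocks (unitTorusGeo L k M) (blkPair (blkFine L k M))) (stack G (fun μ => Dc μ ∘ₗ G)) (fun y y' => β * Real.exp (-(δ * tdistT M y y'))) :=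
    hasMaj_stack (g := unitTorusGeo L k M) (blkFine L k M) hβe hG hGD
  have hSG' : HasMaj (BlockNorm.ofBlocks (unitTorusGeo L k M) (fun i : Tor (fine (L ^ m * L ^ k) M) × Fin (d + 1) => blockOf (L ^ m * L ^ k) M i.1)) (BlockNorm.ofBlocks (unitTorusGeo L k M) (blkPair fun i : Tor (fine (L ^ m * L ^ k) M) × Fin (d + 1) => blockOf (L ^ m * L ^ k) M i.1))
      (stack G' (fun μ => Df μ ∘ₗ G')) (fun y y' => β * Real.exp (-(δ * tdistT M y y'))) :=
    hasMaj_stack (g := unitTorusGeo L k M) _ hβe hG' hG'D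
  have hSD : HasMaj (BlockNorm.ofBlocks (unitTorusGeo L k M) (blkFine L k M)) (BlockNorm.ofBlocks (unitTorusGeo L k M) (blkPair fun i : Tor (fine (L ^ m * L ^ k) M) × Fin (d + 1) => blockOf (L ^ m * L ^ k) M i.1))
      (idef (pull (kingPrV L k m M)) (pull (liftPair (J := Fin (d + 1)) (kingPrV L k m M))) (stack G' (fun μ => Df μ ∘ₗ G')) (stack G (fun μ => Dc μ ∘ₗ G)))
      (fun y y' => mG * Real.exp (-(δ * tdistT M y y'))) := by
    rw [idef_stack]
    exact hasMaj_stack (g := unitTorusGeo L k M) _ hme hDG hDD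
  -- the perturbation letters, unstacked
  have hV := (hasMaj_unstack (g := unitTorusGeo L k M) (blkFine L k M) hr hc ha).mono fun y y' => diagK_const_mono hR y y'
  have hV' := (hasMaj_unstack (g := unitTorusGeo L k M) (fun i : Tor (fine (L ^ m * L ^ k) M) × Fin (d + 1) => blockOf (L ^ m * L ^ k) M i.1) hr hc' ha').mono
    fun y y' => diagK_const_mono hR y y'
  -- the coarse jet and its components
  have hX := hasMaj_bgPropV (g := unitTorusGeo L k M) (blkFine L k M) (blkPair (blkFine L k M)) htri hd hrow hσ hρ hρδ hβ hRd hSG hV hq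
  have hXv : HasMaj (BlockNorm.ofBlocks (unitTorusGeo L k M) (blkFine L k M)) (BlockNorm.ofBlocks (unitTorusGeo L k M) (blkFine L k M)) (projO none ∘ₗ bgPair G (fun μ => Dc μ ∘ₗ G) c a) (fun y y' => βX * Real.exp (-(ρ * tdistT M y y'))) :=
    hasMaj_projO_comp (g := unitTorusGeo L k M) (blkFine L k M) hX none
  have hYb : ∀ μ, HasMaj (BlockNorm.ofBlocks (unitTorusGeo L k M) (blkFine L k M)) (BlockNorm.ofBlocks (unitTorusGeo L k M) (blkFine L k M)) (projO (some μ) ∘ₗ bgPair G (fun μ => Dc μ ∘ₗ G) c a) (fun y y' => βX * Real.exp (-(ρ * tdistT M y y'))) := fun μ =>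
    hasMaj_projO_comp (g := unitTorusGeo L k M) (blkFine L k M) hX (some μ)
  -- (d) THE SANDWICHED COEFFICIENT DEFECT: the `c′`-part comes as the two ROW HYPOTHESES `hGc` (producer: M-C) and `hDGc` (producers: III-A's level split, or a kernel-profile row)
  have hcG : HasMaj (BlockNorm.ofBlocks (unitTorusGeo L k M) (blkFine L k M)) (BlockNorm.ofBlocks (unitTorusGeo L k M) (fun i : Tor (fine (L ^ m * L ^ k) M) × Fin (d + 1) => blockOf (L ^ m * L ^ k) M i.1))
      (G' ∘ₗ idef (pull (kingPrV L k m M)) (pull (kingPrV L k m M)) (mulOp c') (mulOp c)) (fun y y' => ζ₀ * Real.exp (-(δ * (unitTorusGeo L k M).dist y y'))) := hGc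
  have hcD : ∀ ν, HasMaj (BlockNorm.ofBlocks (unitTorusGeo L k M) (blkFine L k M)) (BlockNorm.ofBlocks (unitTorusGeo L k M) (fun i : Tor (fine (L ^ m * L ^ k) M) × Fin (d + 1) => blockOf (L ^ m * L ^ k) M i.1))
      (Df ν ∘ₗ G' ∘ₗ idef (pull (kingPrV L k m M)) (pull (kingPrV L k m M)) (mulOp c') (mulOp c)) (fun y y' => ζ * Real.exp (-(δ * (unitTorusGeo L k M).dist y y'))) := fun ν => hDGc ν
  -- (iii)/(iv) the `a′`-part: the fit letter, diagonal
  have hfit : ∀ μ, HasMaj (BlockNorm.ofBlocks (unitTorusGeo L k M) (blkFine L k M)) (BlockNorm.ofBlocks (unitTorusGeo L k M) (fun i : Tor (fine (L ^ m * L ^ k) M) × Fin (d + 1) => blockOf (L ^ m * L ^ k) M i.1)) (idef (pull (kingPrV L k m M)) (pull (kingPrV L k m M)) (mulOp (a' μ)) (mulOp (a μ))) (diagK fun _ => oa) := by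
    intro μ
    have h := hasMaj_idef_mulOp (g := unitTorusGeo L k M) (blkFine L k M) (kingPrV L k m M) (a' := a' μ) (a := a μ) (o := fun _ => oa) (fun _ => hoa) fun z => hfa μ z
    rw [hblk] at h
    exact h
  have haG : ∀ μ, HasMaj (BlockNorm.ofBlocks (unitTorusGeo L k M) (blkFine L k M)) (BlockNorm.ofBlocks (unitTorusGeo L k M) (fun i : Tor (fine (L ^ m * L ^ k) M) × Fin (d + 1) => blockOf (L ^ m * L ^ k) M i.1)) (G' ∘ₗ idef (pull (kingPrV L k m M)) (pull (kingPrV L k m M)) (mulOp (a' μ)) (mulOp (a μ))) (fun y y' => β * oa * Real.exp (-(δ * (unitTorusGeo L k M).dist y y'))) := fun μ =>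
    hasMaj_comp_diagK_const (g := unitTorusGeo L k M) _ (blkFine L k M) hβ hG' (hfit μ)
  have haD : ∀ ν μ, HasMaj (BlockNorm.ofBlocks (unitTorusGeo L k M) (blkFine L k M)) (BlockNorm.ofBlocks (unitTorusGeo L k M) (fun i : Tor (fine (L ^ m * L ^ k) M) × Fin (d + 1) => blockOf (L ^ m * L ^ k) M i.1)) ((Df ν ∘ₗ G') ∘ₗ idef (pull (kingPrV L k m M)) (pull (kingPrV L k m M)) (mulOp (a' μ)) (mulOp (a μ))) (fun y y' => β * oa * Real.exp (-(δ * (unitTorusGeo L k M).dist y y'))) :=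
    fun ν μ => hasMaj_comp_diagK_const (g := unitTorusGeo L k M) _ (blkFine L k M) hβ (hG'D ν) (hfit μ)
  -- compose with the jet components at the rate `ρ`
  have hWG : HasMaj (BlockNorm.ofBlocks (unitTorusGeo L k M) (blkFine L k M)) (BlockNorm.ofBlocks (unitTorusGeo L k M) (fun i : Tor (fine (L ^ m * L ^ k) M) × Fin (d + 1) => blockOf (L ^ m * L ^ k) M i.1)) (G' ∘ₗ (idef (pull (kingPrV L k m M)) (pull (kingPrV L k m M)) (mulOp c') (mulOp c) ∘ₗ (projO none ∘ₗ bgPair G (fun μ => Dc μ ∘ₗ G) c a) +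
        ∑ μ, idef (pull (kingPrV L k m M)) (pull (kingPrV L k m M)) (mulOp (a' μ)) (mulOp (a μ)) ∘ₗ (projO (some μ) ∘ₗ bgPair G (fun μ => Dc μ ∘ₗ G) c a)))
      (fun y y' => (ζ₀ + (d + 1) * (β * oa)) * βX * cr * Real.exp (-(ρ * tdistT M y y'))) := by
    have e1 := hasMaj_comp_exp (b₁ := (BlockNorm.ofBlocks (unitTorusGeo L k M) (blkFine L k M))) (b₂ := (BlockNorm.ofBlocks (unitTorusGeo L k M) (blkFine L k M))) (b₃ := (BlockNorm.ofBlocks (unitTorusGeo L k M) (fun i : Tor (fine (L ^ m * L ^ k) M) × Fin (d + 1) => blockOf (L ^ m * L ^ k) M i.1))) htri hd hrow hζ₀ hβX hρ le_rfl hρδ hcG hXv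
    have e2 := hasMaj_finsum (b₁ := (BlockNorm.ofBlocks (unitTorusGeo L k M) (blkFine L k M))) (b₂ := (BlockNorm.ofBlocks (unitTorusGeo L k M) (fun i : Tor (fine (L ^ m * L ^ k) M) × Fin (d + 1) => blockOf (L ^ m * L ^ k) M i.1))) Finset.univ (fun μ => (G' ∘ₗ idef (pull (kingPrV L k m M)) (pull (kingPrV L k m M)) (mulOp (a' μ)) (mulOp (a μ))) ∘ₗ (projO (some μ) ∘ₗ bgPair G (fun μ => Dc μ ∘ₗ G) c a))
      (fun _ y y' => (BlockNorm.ofBlocks (unitTorusGeo L k M) (blkFine L k M)).κ * (β * oa) * βX * cr * Real.exp (-(ρ * tdistT M y y')))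
      fun μ _ => hasMaj_comp_exp (b₁ := (BlockNorm.ofBlocks (unitTorusGeo L k M) (blkFine L k M))) (b₂ := (BlockNorm.ofBlocks (unitTorusGeo L k M) (blkFine L k M))) (b₃ := (BlockNorm.ofBlocks (unitTorusGeo L k M) (fun i : Tor (fine (L ^ m * L ^ k) M) × Fin (d + 1) => blockOf (L ^ m * L ^ k) M i.1))) htri hd hrow (mul_nonneg hβ hoa) hβX hρ le_rfl hρδ (haG μ) (hYb μ)
    have hop : G' ∘ₗ (idef (pull (kingPrV L k m M)) (pull (kingPrV L k m M)) (mulOp c') (mulOp c) ∘ₗ (projO none ∘ₗ bgPair G (fun μ => Dc μ ∘ₗ G) c a) +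
        ∑ μ, idef (pull (kingPrV L k m M)) (pull (kingPrV L k m M)) (mulOp (a' μ)) (mulOp (a μ)) ∘ₗ (projO (some μ) ∘ₗ bgPair G (fun μ => Dc μ ∘ₗ G) c a)) =
        (G' ∘ₗ idef (pull (kingPrV L k m M)) (pull (kingPrV L k m M)) (mulOp c') (mulOp c)) ∘ₗ (projO none ∘ₗ bgPair G (fun μ => Dc μ ∘ₗ G) c a) +
          ∑ μ, (G' ∘ₗ idef (pull (kingPrV L k m M)) (pull (kingPrV L k m M)) (mulOp (a' μ)) (mulOp (a μ))) ∘ₗ (projO (some μ) ∘ₗ bgPair G (fun μ => Dc μ ∘ₗ G) c a) := by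
      refine LinearMap.ext fun f => ?_
      simp only [LinearMap.comp_apply, LinearMap.add_apply, LinearMap.sum_apply, map_add, map_sum]
    rw [hop]
    refine (e1.add e2).mono fun y y' => le_of_eq ?_
    rw [sum_const, card_univ, Fintype.card_fin, nsmul_eq_mul]
    simp only [kappa_ofBlocks]
    push_cast
    ring
  have hWD : ∀ ν, HasMaj (BlockNorm.ofBlocks (unitTorusGeo L k M) (blkFine L k M)) (BlockNorm.ofBlocks (unitTorusGeo L k M) (fun i : Tor (fine (L ^ m * L ^ k) M) × Fin (d + 1) => blockOf (L ^ m * L ^ k) M i.1)) ((Df ν ∘ₗ G') ∘ₗ (idef (pull (kingPrV L k m M)) (pull (kingPrV L k m M)) (mulOp c') (mulOp c) ∘ₗ (projO none ∘ₗ bgPair G (fun μ => Dc μ ∘ₗ G) c a) +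
        ∑ μ, idef (pull (kingPrV L k m M)) (pull (kingPrV L k m M)) (mulOp (a' μ)) (mulOp (a μ)) ∘ₗ (projO (some μ) ∘ₗ bgPair G (fun μ => Dc μ ∘ₗ G) c a)))
      (fun y y' => (ζ + (d + 1) * (β * oa)) * βX * cr * Real.exp (-(ρ * tdistT M y y'))) := by
    intro ν
    have e1 := hasMaj_comp_exp (b₁ := (BlockNorm.ofBlocks (unitTorusGeo L k M) (blkFine L k M))) (b₂ := (BlockNorm.ofBlocks (unitTorusGeo L k M) (blkFine L k M))) (b₃ := (BlockNorm.ofBlocks (unitTorusGeo L k M) (fun i : Tor (fine (L ^ m * L ^ k) M) × Fin (d + 1) => blockOf (L ^ m * L ^ k) M i.1))) htri hd hrow hζ hβX hρ le_rfl hρδ (hcD ν) hXv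
    have e2 := hasMaj_finsum (b₁ := (BlockNorm.ofBlocks (unitTorusGeo L k M) (blkFine L k M))) (b₂ := (BlockNorm.ofBlocks (unitTorusGeo L k M) (fun i : Tor (fine (L ^ m * L ^ k) M) × Fin (d + 1) => blockOf (L ^ m * L ^ k) M i.1))) Finset.univ
      (fun μ => ((Df ν ∘ₗ G') ∘ₗ idef (pull (kingPrV L k m M)) (pull (kingPrV L k m M)) (mulOp (a' μ)) (mulOp (a μ))) ∘ₗ (projO (some μ) ∘ₗ bgPair G (fun μ => Dc μ ∘ₗ G) c a))
      (fun _ y y' => (BlockNorm.ofBlocks (unitTorusGeo L k M) (blkFine L k M)).κ * (β * oa) * βX * cr * Real.exp (-(ρ * tdistT M y y')))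
      fun μ _ => hasMaj_comp_exp (b₁ := (BlockNorm.ofBlocks (unitTorusGeo L k M) (blkFine L k M))) (b₂ := (BlockNorm.ofBlocks (unitTorusGeo L k M) (blkFine L k M))) (b₃ := (BlockNorm.ofBlocks (unitTorusGeo L k M) (fun i : Tor (fine (L ^ m * L ^ k) M) × Fin (d + 1) => blockOf (L ^ m * L ^ k) M i.1))) htri hd hrow (mul_nonneg hβ hoa) hβX hρ le_rfl hρδ (haD ν μ) (hYb μ)
    have hop : (Df ν ∘ₗ G') ∘ₗ (idef (pull (kingPrV L k m M)) (pull (kingPrV L k m M)) (mulOp c') (mulOp c) ∘ₗ (projO none ∘ₗ bgPair G (fun μ => Dc μ ∘ₗ G) c a) +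
        ∑ μ, idef (pull (kingPrV L k m M)) (pull (kingPrV L k m M)) (mulOp (a' μ)) (mulOp (a μ)) ∘ₗ (projO (some μ) ∘ₗ bgPair G (fun μ => Dc μ ∘ₗ G) c a)) =
        (Df ν ∘ₗ G' ∘ₗ idef (pull (kingPrV L k m M)) (pull (kingPrV L k m M)) (mulOp c') (mulOp c)) ∘ₗ (projO none ∘ₗ bgPair G (fun μ => Dc μ ∘ₗ G) c a) +
          ∑ μ, ((Df ν ∘ₗ G') ∘ₗ idef (pull (kingPrV L k m M)) (pull (kingPrV L k m M)) (mulOp (a' μ)) (mulOp (a μ))) ∘ₗ (projO (some μ) ∘ₗ bgPair G (fun μ => Dc μ ∘ₗ G) c a) := by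
      refine LinearMap.ext fun f => ?_
      simp only [LinearMap.comp_apply, LinearMap.add_apply, LinearMap.sum_apply, map_add, map_sum]
    rw [hop]
    refine (e1.add e2).mono fun y y' => le_of_eq ?_
    rw [sum_const, card_univ, Fintype.card_fin, nsmul_eq_mul]
    simp only [kappa_ofBlocks]
    push_cast
    ring
  -- stack the two fronts: binder (d) sandwiched
  have hcG1 : 0 ≤ (ζ₀ + (d + 1) * (β * oa)) * BX * cr := by positivity
  have hcD0 : 0 ≤ ζ + (d + 1) * (β * oa) := by positivity
  have hcD1 : 0 ≤ (ζ + (d + 1) * (β * oa)) * BX * cr := by positivity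
  set W := idef (pull (kingPrV L k m M)) (pull (kingPrV L k m M)) (mulOp c') (mulOp c) ∘ₗ (projO none ∘ₗ bgPair G (fun μ => Dc μ ∘ₗ G) c a) +
      ∑ μ, idef (pull (kingPrV L k m M)) (pull (kingPrV L k m M)) (mulOp (a' μ)) (mulOp (a μ)) ∘ₗ (projO (some μ) ∘ₗ bgPair G (fun μ => Dc μ ∘ₗ G) c a) with hW_def
  have hW : idef (pull (liftPair (J := Fin (d + 1)) (kingPrV L k m M))) (pull (kingPrV L k m M)) (unstack c' a') (unstack c a) ∘ₗ
      bgPropV (stack G (fun μ => Dc μ ∘ₗ G)) (unstack c a) = W := by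
    rw [hW_def, idef_unstack_eq]
    refine LinearMap.ext fun f => ?_
    simp only [LinearMap.comp_apply, LinearMap.add_apply, LinearMap.sum_apply, bgPair]
  have hWG' : HasMaj (BlockNorm.ofBlocks (unitTorusGeo L k M) (blkFine L k M))
      (BlockNorm.ofBlocks (unitTorusGeo L k M) (fun i : Tor (fine (L ^ m * L ^ k) M) × Fin (d + 1) => blockOf (L ^ m * L ^ k) M i.1)) (G' ∘ₗ W)
      (fun y y' => (((ζ₀ + (d + 1) * (β * oa)) * BX * cr +
          (ζ + (d + 1) * (β * oa)) * BX * cr)) * Real.exp (-(ρ * tdistT M y y'))) := by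
    refine hWG.mono fun y y' => ?_
    have hE := Real.exp_nonneg (-(ρ * tdistT M y y'))
    have h1 : (ζ₀ + (d + 1) * (β * oa)) * βX * cr ≤ (ζ₀ + (d + 1) * (β * oa)) * BX * cr :=
      mul_le_mul_of_nonneg_right (mul_le_mul_of_nonneg_left hBX (by positivity)) hcr
    exact mul_le_mul_of_nonneg_right (h1.trans (le_add_of_nonneg_right hcD1)) hE
  have hWD' : ∀ ν, HasMaj (BlockNorm.ofBlocks (unitTorusGeo L k M) (blkFine L k M))
      (BlockNorm.ofBlocks (unitTorusGeo L k M) (fun i : Tor (fine (L ^ m * L ^ k) M) × Fin (d + 1) => blockOf (L ^ m * L ^ k) M i.1)) ((Df ν ∘ₗ G') ∘ₗ W)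
      (fun y y' => (((ζ₀ + (d + 1) * (β * oa)) * BX * cr +
          (ζ + (d + 1) * (β * oa)) * BX * cr)) * Real.exp (-(ρ * tdistT M y y'))) := by
    intro ν
    refine (hWD ν).mono fun y y' => ?_
    have hE := Real.exp_nonneg (-(ρ * tdistT M y y'))
    have h1 : (ζ + (d + 1) * (β * oa)) * βX * cr ≤
        (ζ + (d + 1) * (β * oa)) * BX * cr :=
      mul_le_mul_of_nonneg_right (mul_le_mul_of_nonneg_left hBX hcD0) hcr
    exact mul_le_mul_of_nonneg_right (h1.trans (le_add_of_nonneg_left hcG1)) hE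
  have hst : stack G' (fun μ => Df μ ∘ₗ G') ∘ₗ idef (pull (liftPair (J := Fin (d + 1)) (kingPrV L k m M))) (pull (kingPrV L k m M)) (unstack c' a') (unstack c a) ∘ₗ
      bgPropV (stack G (fun μ => Dc μ ∘ₗ G)) (unstack c a) = stack (G' ∘ₗ W) (fun ν => (Df ν ∘ₗ G') ∘ₗ W) := by
    rw [hW, stack_comp]
  have hDVs : HasMaj (BlockNorm.ofBlocks (unitTorusGeo L k M) (blkFine L k M))
      (BlockNorm.ofBlocks (unitTorusGeo L k M) (blkPair fun i : Tor (fine (L ^ m * L ^ k) M) × Fin (d + 1) => blockOf (L ^ m * L ^ k) M i.1))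
      (stack G' (fun μ => Df μ ∘ₗ G') ∘ₗ idef (pull (liftPair (J := Fin (d + 1)) (kingPrV L k m M))) (pull (kingPrV L k m M)) (unstack c' a') (unstack c a) ∘ₗ
        bgPropV (stack G (fun μ => Dc μ ∘ₗ G)) (unstack c a))
      (fun y y' => (((ζ₀ + (d + 1) * (β * oa)) * BX * cr +
          (ζ + (d + 1) * (β * oa)) * BX * cr)) * Real.exp (-(ρ * tdistT M y y'))) := by
    rw [hst]
    exact hasMaj_stack (g := unitTorusGeo L k M) _ (fun _ _ => mul_nonneg (add_nonneg hcG1 hcD1) (Real.exp_nonneg _)) hWG' hWD'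
  -- n15-b's device, sandwiched edition
  have hSG'' := hSG'
  rw [← hblk2, ← hblk] at hSG''
  have hSD' := hSD
  rw [← hblk2] at hSD'
  have hV'' := hV'
  rw [← hblk2, ← hblk] at hV''
  have hDVs' := hDVs
  rw [← hblk2] at hDVs'
  have key := hasMaj_idef_bgPropV_of_sandwich (g := unitTorusGeo L k M) (blkFine L k M) (blkPair (blkFine L k M)) (kingPrV L k m M)
    (liftPair (J := Fin (d + 1)) (kingPrV L k m M)) htri hd hσ hrow hρ hρδ hβ hRd
    (cV := (ζ₀ + (d + 1) * (β * oa)) * BX * cr +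
      (ζ + (d + 1) * (β * oa)) * BX * cr)
    (by positivity) hmG (G := stack G (fun μ => Dc μ ∘ₗ G)) (V := unstack c a) (G' := stack G' (fun μ => Df μ ∘ₗ G')) (V' := unstack c' a')
    hSG hSG'' hSD' hV hV'' hDVs' hq
  rw [hblk2] at key
  exact key

/-- ★★ **EACH COMPONENT OF THE DRESSED JET — IN PARTICULAR THE GRADIENT ENTRY `𝔇(∇′_νX′, ∇_νX)` — inherits the jet's majorant** (`projO j`; the value entry `j = none` is II-C's by
another road). [cite: Balaban1985BackgroundPropagators, Thm 3.1 (3.42) p.397 (entries 0 and 1: shape)] -/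
theorem hasMaj_projO_idef_bgPair {K : Tor M → Tor M → ℝ}
    {Xh' : (Tor (fine (L ^ m * L ^ k) M) × Fin (d + 1) → ℝ) →ₗ[ℝ] (Tor (fine (L ^ m * L ^ k) M) × Fin (d + 1)) × Option (Fin (d + 1)) → ℝ}
    {Xh : (Tor (fine (L ^ k) M) × Fin (d + 1) → ℝ) →ₗ[ℝ] (Tor (fine (L ^ k) M) × Fin (d + 1)) × Option (Fin (d + 1)) → ℝ}
    (h : HasMaj (BlockNorm.ofBlocks (unitTorusGeo L k M) (blkFine L k M))
      (BlockNorm.ofBlocks (unitTorusGeo L k M) (blkPair fun i : Tor (fine (L ^ m * L ^ k) M) × Fin (d + 1) => blockOf (L ^ m * L ^ k) M i.1))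
      (idef (pull (kingPrV L k m M)) (pull (liftPair (J := Fin (d + 1)) (kingPrV L k m M))) Xh' Xh) K) (j : Option (Fin (d + 1))) :
    HasMaj (BlockNorm.ofBlocks (unitTorusGeo L k M) (blkFine L k M))
      (BlockNorm.ofBlocks (unitTorusGeo L k M) (fun i : Tor (fine (L ^ m * L ^ k) M) × Fin (d + 1) => blockOf (L ^ m * L ^ k) M i.1))
      (idef (pull (kingPrV L k m M)) (pull (kingPrV L k m M)) (projO j ∘ₗ Xh') (projO j ∘ₗ Xh)) K := by
  have hcomp : idef (pull (kingPrV L k m M)) (pull (kingPrV L k m M)) (projO j ∘ₗ Xh') (projO j ∘ₗ Xh) =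
      projO j ∘ₗ idef (pull (kingPrV L k m M)) (pull (liftPair (J := Fin (d + 1)) (kingPrV L k m M))) Xh' Xh :=
    LinearMap.ext fun v => funext fun x' => rfl
  rw [hcomp]
  exact hasMaj_projO_comp (g := unitTorusGeo L k M) _ h j

end Jet

end Summit.QuantumFields.YangMills.BalabanUVNodes.N15.TwoGrid

end
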